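import Summits.QuantumFields.YangMills.Theorems.BalabanUVNodesN08AlphaLiftAvgCont
import Summits.QuantumFields.Balaban3D.Proofs.AdmissibleRegions

/-!
# Route «BalabanUVNodes», Track-A DAG node N08 = [Balaban1985UV3] — (α) clause, the in-edge sentence (b11‴) CONSTRUCTED, part 4:
# THE COLLAR GEOMETRY OF A HISTORY — fine separations from (38)–(39), the distance to `Ω_j(h)`, and the cut-offs `θ_j` blending the scales

Cell `pub-ymgap`, seat `pub-ymgap-dag-n08-d` gen 5, file F4 (torus side; over `…N08AlphaLiftAvgCont` and the lane's `AdmissibleRegions` ∕ `Run3Collar` ∕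
`CollarCount`).  `bears_on: R4∕N08`; filed `--supports stmt-QuantumFields-19910 --as helper`.  Sorry-free, standard axioms.

CONTENTS ([folklore] torus combinatorics over the lane's regions `Carriers.Omega`):
* §1 `sdist_le_tdist_div_add`: the scale-`j` block distance is at most the fine `ℓ¹` distance `/ L^j + d` (`CollarCount.coarse_dist_le` per coordinate);
  hence `tdist ≥ (sdist − d)·L^j`.
* §2 ★ `rcol_lt_sdist_of_mem_Omega_succ`: for `j + 1 ≤ k`, a site of `Ω_{j+1}(h)` is at scale-`j` distance `> Rcol j` from every site covered by a
  plaquette of `P_j(h)` and from every site outside `Ω_j(h)` ((39) p. 266 as built into `Carriers.Omega`, read at the truncation by `Run3Collar.Omega_castLE`);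
  `tdist_ge_of_mem_Omega_succ`: hence at fine distance `≥ (Rcol j + 1 − d)·L^j`.
* §3 `distTo T x` (fine `ℓ¹` distance to a set of torus sites; `sInf`, so `0` for the empty set), `1`-Lipschitz.
* §4 the clamp `clamp01` and the cut-off `theta T W x = clamp01 (1 − (distTo T x − 2)/W)` (`= 1` within distance `2` of `T`, `= 0` from distance `W + 2`,
  `1/W`-Lipschitz, `≡ 0` if `T = ∅`).
* §5 for a history `h` of `k` steps with collars `Rcol j ≥ R + 6` (`j + 1 ≤ k`): the scale cut-offs `Theta R k h j = theta (Ω_j(h)) (R·L^{j−1})` (`j ≥ 1`; `1` at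
  `j = 0`, `0` for `j ≥ k`): ★ `Theta_succ_eq_zero_near_bad` (vanishing of `θ_{j+1}` within fine distance `2` of the covers of `P_j` and of `Ω_jᶜ`),
  ★ `Theta_succ_le` (`θ_{j+1} ≤ θ_j`), `Theta_eq_one_of_distTo_le_two`, and the Lipschitz bound `abs_Theta_sub_le`.
HONEST FRAMING: kernel bookkeeping; nothing of [B10] asserted; count-neutral; NOT a discharge of N08.  d = 3 lattice gauge theory on finite tori as printed.
-/

noncomputable section

namespace Summit.QuantumFields.YangMills.Theorems.BalabanUVNodesN08AlphaHistGeom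

open Literature.MathematicalPhysics.QuantumFieldTheory.Balaban1983to89
open Literature.MathematicalPhysics.QuantumFieldTheory.Balaban1985CMP102.Setting
open Summit.QuantumFields.Balaban3D.Carriers
open Summit.QuantumFields.Balaban3D.Proofs.Run3Collar (Omega_castLE sdist_comm)
open Summit.QuantumFields.Balaban3D.Proofs.CollarCount (coarse_dist_le sum_div_le)
open Summit.QuantumFields.Balaban3D.Proofs.TorusLift (val_coarsen)
open Summit.QuantumFields.YangMills.Theorems.BalabanUVNodesN08AlphaLiftAvgCont (sitesPerDir_zero_eq)
open B3Taylor310LocalRemainder (tdist_comm tdist_triangle)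
open Finset

variable {L : ℕ} {S : Scales L}

/-! ## §1 Block distance versus fine distance -/

/-- **CONTRACTION ACROSS `j` SCALES AT ONCE**: `sdist j x y ≤ tdist x y / L^j + d` (`j ≤ m + K`). [folklore] -/
theorem sdist_le_tdist_div_add {j : ℕ} (hj : j ≤ S.P.m + S.P.K) (x y : Site S.P 0) :
    sdist j x y ≤ Site.tdist x y / S.P.L ^ j + S.P.d := by
  have hLj : 0 < S.P.L ^ j := pow_pos S.P.L_pos j
  have hn : S.P.sitesPerDir 0 = S.P.sitesPerDir j * S.P.L ^ j := by rw [sitesPerDir_zero_eq hj, mul_comm]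
  have hcoord : ∀ μ : Fin S.P.d,
      min ((coarsen j x) μ - (coarsen j y) μ).val ((coarsen j y) μ - (coarsen j x) μ).val ≤
        min (x μ - y μ).val (y μ - x μ).val / S.P.L ^ j + 1 :=
    fun μ => coarse_dist_le hn hLj (x μ) (y μ) _ _ (val_coarsen j hj x μ) (val_coarsen j hj y μ)
  unfold sdist Site.tdist
  calc ∑ μ, min ((coarsen j x) μ - (coarsen j y) μ).val ((coarsen j y) μ - (coarsen j x) μ).val
      ≤ ∑ μ, (min (x μ - y μ).val (y μ - x μ).val / S.P.L ^ j + 1) := Finset.sum_le_sum fun μ _ => hcoord μ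
    _ = ∑ μ, min (x μ - y μ).val (y μ - x μ).val / S.P.L ^ j + S.P.d := by rw [Finset.sum_add_distrib]; simp
    _ ≤ (∑ μ, min (x μ - y μ).val (y μ - x μ).val) / S.P.L ^ j + S.P.d := Nat.add_le_add_right (sum_div_le _ _ _) _

/-- **Hence `tdist x y ≥ (sdist j x y − d)·L^j`.** [folklore] -/
theorem tdist_ge_of_sdist {j : ℕ} (hj : j ≤ S.P.m + S.P.K) (x y : Site S.P 0) :
    (sdist j x y - S.P.d) * S.P.L ^ j ≤ Site.tdist x y := by
  have hLj : 0 < S.P.L ^ j := pow_pos S.P.L_pos j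
  have h := sdist_le_tdist_div_add hj x y
  have h2 : sdist j x y - S.P.d ≤ Site.tdist x y / S.P.L ^ j := Nat.sub_le_iff_le_add.2 h
  exact (Nat.le_div_iff_mul_le hLj).1 h2

/-! ## §2 The collar (39): separation of `Ω_{j+1}(h)` from the covers of `P_j(h)` and from `Ω_j(h)ᶜ` -/

section Collar

variable (M₁ : ℕ) (Rcol : ℕ → ℕ)

/-- **★ (39) AT EVERY RECORDED SCALE**: for `j + 1 ≤ k` and `y ∈ Ω_{j+1}(h)`, every site `x` covered by a plaquette of `P_j(h)` or outside `Ω_j(h)` has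
`sdist j x y > Rcol j`. [cite: Balaban1985UV3, (39) p.266] -/
theorem rcol_lt_sdist_of_mem_Omega_succ {k : ℕ} (h : Hist S.P k) {j : ℕ} (hjk : j + 1 ≤ k) {y : Site S.P 0}
    (hy : y ∈ Omega M₁ Rcol k h (j + 1)) {x : Site S.P 0}
    (hx : (∃ p ∈ h ⟨j, hjk⟩, x ∈ plaqCover p) ∨ x ∉ Omega M₁ Rcol k h j) : Rcol j < sdist j x y := by
  set h' : Hist S.P (j + 1) := fun i => h (Fin.castLE hjk i) with hh'
  rw [Omega_castLE M₁ Rcol k h (j + 1) hjk, mem_Omega_succ_self] at hy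
  refine hy y rfl x ?_
  rcases hx with ⟨p, hp, hxp⟩ | hxΩ
  · exact Or.inl ⟨p, hp, hxp⟩
  · right
    rw [Omega_castLE M₁ Rcol k h j (by omega)] at hxΩ
    exact hxΩ

/-- **… hence at fine distance `≥ (Rcol j + 1 − d)·L^j`.** [cite: Balaban1985UV3, (39) p.266] -/
theorem tdist_ge_of_mem_Omega_succ {k : ℕ} (hk : k ≤ S.P.m + S.P.K) (h : Hist S.P k) {j : ℕ} (hjk : j + 1 ≤ k) {y : Site S.P 0}
    (hy : y ∈ Omega M₁ Rcol k h (j + 1)) {x : Site S.P 0}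
    (hx : (∃ p ∈ h ⟨j, hjk⟩, x ∈ plaqCover p) ∨ x ∉ Omega M₁ Rcol k h j) :
    (Rcol j + 1 - S.P.d) * S.P.L ^ j ≤ Site.tdist x y := by
  have h1 := rcol_lt_sdist_of_mem_Omega_succ M₁ Rcol h hjk hy hx
  have h2 := tdist_ge_of_sdist (S := S) (show j ≤ S.P.m + S.P.K by omega) x y
  have hLj : 0 < S.P.L ^ j := pow_pos S.P.L_pos j
  exact le_trans (Nat.mul_le_mul_right _ (by omega)) h2

end Collar

/-! ## §3 The fine distance to a set of torus sites -/

/-- **THE FINE `ℓ¹` DISTANCE TO A SET** (`0` for the empty set). [folklore] -/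
def distTo (T : Set (Site S.P 0)) (x : Site S.P 0) : ℕ := sInf {n | ∃ y ∈ T, Site.tdist x y = n}

/-- `distTo T x ≤ tdist x y` for `y ∈ T`. [folklore] -/
theorem distTo_le {T : Set (Site S.P 0)} {x y : Site S.P 0} (hy : y ∈ T) : distTo T x ≤ Site.tdist x y :=
  Nat.sInf_le ⟨y, hy, rfl⟩

/-- The distance is attained. [folklore] -/
theorem exists_tdist_eq_distTo {T : Set (Site S.P 0)} (hT : T.Nonempty) (x : Site S.P 0) : ∃ y ∈ T, Site.tdist x y = distTo T x := by
  obtain ⟨y₀, hy₀⟩ := hT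
  have : ({n | ∃ y ∈ T, Site.tdist x y = n} : Set ℕ).Nonempty := ⟨_, y₀, hy₀, rfl⟩
  exact Nat.sInf_mem this

/-- A lower bound on all distances is a lower bound on `distTo` (non-empty `T`). [folklore] -/
theorem le_distTo {T : Set (Site S.P 0)} (hT : T.Nonempty) {x : Site S.P 0} {n : ℕ} (h : ∀ y ∈ T, n ≤ Site.tdist x y) : n ≤ distTo T x := by
  obtain ⟨y, hy, hyd⟩ := exists_tdist_eq_distTo hT x
  rw [← hyd]; exact h y hy

/-- `tdist x x = 0`. [folklore] -/
theorem tdist_self' (x : Site S.P 0) : Site.tdist x x = 0 := by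
  simp [Site.tdist]

/-- `distTo T x = 0` on `T`. [folklore] -/
theorem distTo_eq_zero_of_mem {T : Set (Site S.P 0)} {x : Site S.P 0} (hx : x ∈ T) : distTo T x = 0 := by
  have := distTo_le (T := T) (x := x) hx
  rw [tdist_self'] at this
  omega

/-- **`distTo` is `1`-Lipschitz**: `distTo T x′ ≤ distTo T x + tdist x x′`. [folklore] -/
theorem distTo_le_distTo_add {T : Set (Site S.P 0)} (hT : T.Nonempty) (x x' : Site S.P 0) : distTo T x' ≤ distTo T x + Site.tdist x x' := by
  obtain ⟨y, hy, hyd⟩ := exists_tdist_eq_distTo hT x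
  calc distTo T x' ≤ Site.tdist x' y := distTo_le hy
    _ ≤ Site.tdist x' x + Site.tdist x y := tdist_triangle _ _ _
    _ = distTo T x + Site.tdist x x' := by rw [hyd, tdist_comm x' x, add_comm]

/-! ## §4 The clamp and the cut-off of a set -/

/-- `clamp01 u = max 0 (min 1 u)`. [folklore] -/
def clamp01 (u : ℝ) : ℝ := max 0 (min 1 u)

/-- `0 ≤ clamp01 u ≤ 1`. [folklore] -/
theorem clamp01_mem (u : ℝ) : 0 ≤ clamp01 u ∧ clamp01 u ≤ 1 :=
  ⟨le_max_left _ _, max_le zero_le_one (min_le_left _ _)⟩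

/-- `clamp01 u = 1` for `u ≥ 1`. [folklore] -/
theorem clamp01_eq_one {u : ℝ} (h : 1 ≤ u) : clamp01 u = 1 := by
  unfold clamp01; rw [min_eq_left h, max_eq_right zero_le_one]

/-- `clamp01 u = 0` for `u ≤ 0`. [folklore] -/
theorem clamp01_eq_zero {u : ℝ} (h : u ≤ 0) : clamp01 u = 0 := by
  unfold clamp01; rw [max_eq_left]; exact (min_le_right _ _).trans h

/-- The clamp is `1`-Lipschitz. [folklore] -/
theorem abs_clamp01_sub_le (u v : ℝ) : |clamp01 u - clamp01 v| ≤ |u - v| := by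
  unfold clamp01
  refine (abs_max_sub_max_le_max _ _ _ _).trans ?_
  rw [sub_self, abs_zero]
  refine max_le (abs_nonneg _) ((abs_min_sub_min_le_max _ _ _ _).trans ?_)
  rw [sub_self, abs_zero]
  exact max_le (abs_nonneg _) le_rfl

/-- **THE CUT-OFF OF A SET AT WIDTH `W`**: `1` within fine distance `2` of `T`, decreasing linearly to `0` at distance `W + 2`; `0` if `T = ∅`. [folklore] -/
def theta (T : Set (Site S.P 0)) (W : ℕ) (x : Site S.P 0) : ℝ := by
  classical exact if T.Nonempty then clamp01 (1 - ((distTo T x : ℝ) - 2) / W) else 0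

/-- `0 ≤ theta ≤ 1`. [folklore] -/
theorem theta_mem (T : Set (Site S.P 0)) (W : ℕ) (x : Site S.P 0) : 0 ≤ theta T W x ∧ theta T W x ≤ 1 := by
  unfold theta; split_ifs
  · exact clamp01_mem _
  · exact ⟨le_rfl, zero_le_one⟩

/-- `theta = 1` within distance `2` of a non-empty `T`. [folklore] -/
theorem theta_eq_one {T : Set (Site S.P 0)} (hT : T.Nonempty) {W : ℕ} (hW : 0 < W) {x : Site S.P 0} (hx : distTo T x ≤ 2) : theta T W x = 1 := by
  unfold theta; rw [if_pos hT]
  refine clamp01_eq_one ?_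
  have : ((distTo T x : ℝ) - 2) / W ≤ 0 := div_nonpos_of_nonpos_of_nonneg (by exact_mod_cast (by omega : (distTo T x : ℤ) - 2 ≤ 0)) (by positivity)
  linarith

/-- `theta = 0` from distance `W + 2` on. [folklore] -/
theorem theta_eq_zero_of_le {T : Set (Site S.P 0)} {W : ℕ} (hW : 0 < W) {x : Site S.P 0} (hx : W + 2 ≤ distTo T x) : theta T W x = 0 := by
  unfold theta; split_ifs
  · refine clamp01_eq_zero ?_
    have hWr : (0 : ℝ) < W := by exact_mod_cast hW
    have hx' : (W : ℝ) + 2 ≤ distTo T x := by exact_mod_cast hx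
    have : (1 : ℝ) ≤ ((distTo T x : ℝ) - 2) / W := by rw [le_div_iff₀ hWr]; linarith
    linarith
  · rfl

/-- `theta = 0` for the empty set. [folklore] -/
theorem theta_eq_zero_of_not_nonempty {T : Set (Site S.P 0)} (hT : ¬ T.Nonempty) (W : ℕ) (x : Site S.P 0) : theta T W x = 0 := by
  unfold theta; rw [if_neg hT]

/-- If `theta T W x ≠ 0` then `T` is non-empty and `distTo T x < W + 2`. [folklore] -/
theorem distTo_lt_of_theta_ne_zero {T : Set (Site S.P 0)} {W : ℕ} (hW : 0 < W) {x : Site S.P 0} (h : theta T W x ≠ 0) :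
    T.Nonempty ∧ distTo T x < W + 2 := by
  by_contra hc
  rw [not_and_or, not_lt] at hc
  rcases hc with hT | hd
  · exact h (theta_eq_zero_of_not_nonempty hT W x)
  · exact h (theta_eq_zero_of_le hW hd)

/-- **The cut-off is `1/W`-Lipschitz in the fine distance.** [folklore] -/
theorem abs_theta_sub_le (T : Set (Site S.P 0)) {W : ℕ} (hW : 0 < W) (x x' : Site S.P 0) :
    |theta T W x - theta T W x'| ≤ (Site.tdist x x' : ℝ) / W := by
  unfold theta
  split_ifs with hT
  · refine (abs_clamp01_sub_le _ _).trans ?_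
    have hWr : (0 : ℝ) < W := by exact_mod_cast hW
    have h1 := distTo_le_distTo_add hT x x'
    have h2 := distTo_le_distTo_add hT x' x
    rw [tdist_comm x' x] at h2
    rw [show (1 - ((distTo T x : ℝ) - 2) / W) - (1 - ((distTo T x' : ℝ) - 2) / W) = ((distTo T x' : ℝ) - distTo T x) / W by ring, abs_div,
      abs_of_pos hWr, div_le_div_iff_of_pos_right hWr, abs_le]
    constructor
    · have : (distTo T x : ℝ) ≤ distTo T x' + Site.tdist x x' := by exact_mod_cast h2
      linarith
    · have : (distTo T x' : ℝ) ≤ distTo T x + Site.tdist x x' := by exact_mod_cast h1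
      linarith
  · rw [sub_self, abs_zero]; positivity

/-! ## §5 The scale cut-offs of a history and their basic properties -/

section History

variable (M₁ : ℕ) (Rcol : ℕ → ℕ) (R : ℕ) {k : ℕ} (h : Hist S.P k)

/-- **THE SCALE CUT-OFFS `θ_j` OF A HISTORY** (`j < k`; width `W_j = R·L^{j−1}` for `j ≥ 1`, `θ_0 ≡ 1`, `θ_j ≡ 0` for `j ≥ k`). [folklore] -/
def Theta (j : ℕ) (x : Site S.P 0) : ℝ :=
  if k ≤ j then 0 else if j = 0 then 1 else theta (Omega M₁ Rcol k h j) (R * S.P.L ^ (j - 1)) x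

/-- `0 ≤ Theta ≤ 1`. [folklore] -/
theorem Theta_mem (j : ℕ) (x : Site S.P 0) : 0 ≤ Theta M₁ Rcol R h j x ∧ Theta M₁ Rcol R h j x ≤ 1 := by
  unfold Theta; split_ifs
  · exact ⟨le_rfl, zero_le_one⟩
  · exact ⟨zero_le_one, le_rfl⟩
  · exact theta_mem _ _ _

/-- `Theta 0 = 1` (for `k ≥ 1`) and `Theta j = 0` for `j ≥ k`. [folklore] -/
theorem Theta_zero (hk : 1 ≤ k) (x : Site S.P 0) : Theta M₁ Rcol R h 0 x = 1 := by
  unfold Theta; rw [if_neg (by omega), if_pos rfl]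

/-- `Theta j = 0` for `j ≥ k`. [folklore] -/
theorem Theta_of_le {j : ℕ} (hj : k ≤ j) (x : Site S.P 0) : Theta M₁ Rcol R h j x = 0 := by
  unfold Theta; rw [if_pos hj]

/-- **`θ_j = 1` within fine distance `2` of `Ω_j(h)`** (`1 ≤ j < k`, `R ≥ 1`; in particular on `Ω_j(h)`). [folklore] -/
theorem Theta_eq_one_of_distTo_le_two (hR : 1 ≤ R) {j : ℕ} (hjk : j < k) {x : Site S.P 0}
    (hne : j = 0 ∨ (Omega M₁ Rcol k h j).Nonempty) (hx : distTo (Omega M₁ Rcol k h j) x ≤ 2) : Theta M₁ Rcol R h j x = 1 := by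
  unfold Theta
  rw [if_neg (by omega)]
  split_ifs with hj0
  · rfl
  · have hne' : (Omega M₁ Rcol k h j).Nonempty := hne.resolve_left hj0
    exact theta_eq_one hne' (Nat.mul_pos hR (pow_pos S.P.L_pos _)) hx

/-- `θ_j = 1` on `Ω_j(h)` (`j < k`). [folklore] -/
theorem Theta_eq_one_of_mem (hR : 1 ≤ R) {j : ℕ} (hjk : j < k) {x : Site S.P 0} (hx : x ∈ Omega M₁ Rcol k h j) :
    Theta M₁ Rcol R h j x = 1 :=
  Theta_eq_one_of_distTo_le_two M₁ Rcol R h hR hjk (Or.inr ⟨x, hx⟩) (by rw [distTo_eq_zero_of_mem hx]; omega)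

/-- **★ THE COLLAR KEEPS `θ_{j+1}` AWAY FROM THE BAD SITES OF SCALE `j`**: if `Rcol j ≥ R + 6`, `j + 1 ≤ k ≤ m + K`, `d = 3`, then for every `x` covered by a
plaquette of `P_j(h)` or outside `Ω_j(h)` and every `x′` at fine distance `≤ 2` from `x`: `θ_{j+1}(x′) = 0`. [cite: Balaban1985UV3, (39) p.266] -/
theorem Theta_succ_eq_zero_near_bad (hd : S.P.d = 3) (hk : k ≤ S.P.m + S.P.K) {j : ℕ} (hjk : j + 1 ≤ k) (hR : 1 ≤ R) (hRcol : R + 6 ≤ Rcol j)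
    {x : Site S.P 0} (hx : (∃ p ∈ h ⟨j, hjk⟩, x ∈ plaqCover p) ∨ x ∉ Omega M₁ Rcol k h j) {x' : Site S.P 0} (hxx' : Site.tdist x x' ≤ 2) :
    Theta M₁ Rcol R h (j + 1) x' = 0 := by
  by_cases hle : k ≤ j + 1
  · exact Theta_of_le M₁ Rcol R h hle x'
  unfold Theta
  rw [if_neg hle, if_neg (Nat.succ_ne_zero j), Nat.add_sub_cancel]
  by_cases hne : (Omega M₁ Rcol k h (j + 1)).Nonempty
  · refine theta_eq_zero_of_le (Nat.mul_pos hR (pow_pos S.P.L_pos _)) ?_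
    have hLj : 1 ≤ S.P.L ^ j := Nat.one_le_pow _ _ S.P.L_pos
    -- distance from `x` to `Ω_{j+1}` is at least `(Rcol j + 1 − 3)·L^j ≥ (R + 4)·L^j ≥ R·L^j + 4`
    have hfar : (R + 4) * S.P.L ^ j ≤ distTo (Omega M₁ Rcol k h (j + 1)) x := by
      refine le_distTo hne fun y hy => ?_
      have := tdist_ge_of_mem_Omega_succ M₁ Rcol hk h hjk hy hx
      rw [hd] at this
      exact le_trans (Nat.mul_le_mul_right _ (by omega)) this
    have hlip := distTo_le_distTo_add hne x' x
    rw [tdist_comm x' x] at hlip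
    have h4 : R * S.P.L ^ j + 4 * S.P.L ^ j ≤ distTo (Omega M₁ Rcol k h (j + 1)) x' + 2 := by rw [← Nat.add_mul]; omega
    omega
  · exact theta_eq_zero_of_not_nonempty hne _ _

/-- **★ MONOTONICITY IN THE SCALE: `θ_{j+1} ≤ θ_j`** (collars `Rcol j ≥ R + 6` for `j + 1 ≤ k`). [folklore] -/
theorem Theta_succ_le (hd : S.P.d = 3) (hk : k ≤ S.P.m + S.P.K) (hR : 1 ≤ R) (hRcol : ∀ j, j + 1 ≤ k → R + 6 ≤ Rcol j) (j : ℕ) (x : Site S.P 0) :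
    Theta M₁ Rcol R h (j + 1) x ≤ Theta M₁ Rcol R h j x := by
  by_cases hjk : j + 1 ≤ k
  · by_cases hz : Theta M₁ Rcol R h (j + 1) x = 0
    · rw [hz]; exact (Theta_mem M₁ Rcol R h j x).1
    · -- `θ_{j+1}(x) ≠ 0` forces `x ∈ Ω_j(h)`, where `θ_j = 1`
      have hxΩ : x ∈ Omega M₁ Rcol k h j := by
        by_contra hxΩ
        exact hz (Theta_succ_eq_zero_near_bad M₁ Rcol R h hd hk hjk hR (hRcol j hjk) (Or.inr hxΩ)
          (by rw [tdist_self']; omega))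
      rw [Theta_eq_one_of_mem M₁ Rcol R h hR (by omega) hxΩ]
      exact (Theta_mem M₁ Rcol R h (j + 1) x).2
  · rw [Theta_of_le M₁ Rcol R h (by omega)]
    exact (Theta_mem M₁ Rcol R h j x).1

/-- Antitonicity `θ_{j'} ≤ θ_j` for `j ≤ j'`. [folklore] -/
theorem Theta_antitone (hd : S.P.d = 3) (hk : k ≤ S.P.m + S.P.K) (hR : 1 ≤ R) (hRcol : ∀ j, j + 1 ≤ k → R + 6 ≤ Rcol j) {j j' : ℕ} (hjj' : j ≤ j')
    (x : Site S.P 0) : Theta M₁ Rcol R h j' x ≤ Theta M₁ Rcol R h j x := by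
  induction hjj' with
  | refl => exact le_rfl
  | step _ ih => exact (Theta_succ_le M₁ Rcol R h hd hk hR hRcol _ x).trans ih

/-- **The scale cut-offs are Lipschitz**: `|θ_j(x) − θ_j(x′)| ≤ tdist x x′ / (R·L^{j−1})` for `1 ≤ j` (and `0` for `j = 0` or `j ≥ k`). [folklore] -/
theorem abs_Theta_sub_le (hR : 1 ≤ R) {j : ℕ} (hj : 1 ≤ j) (x x' : Site S.P 0) :
    |Theta M₁ Rcol R h j x - Theta M₁ Rcol R h j x'| ≤ (Site.tdist x x' : ℝ) / (R * S.P.L ^ (j - 1) : ℕ) := by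
  unfold Theta
  split_ifs with h1 h2
  · rw [sub_self, abs_zero]; positivity
  · omega
  · exact abs_theta_sub_le _ (Nat.mul_pos hR (pow_pos S.P.L_pos _)) x x'

/-- `θ_0` is constant: its differences vanish. [folklore] -/
theorem Theta_zero_sub (x x' : Site S.P 0) : Theta M₁ Rcol R h 0 x - Theta M₁ Rcol R h 0 x' = 0 := by
  unfold Theta
  split_ifs with h1 h2
  · simp
  · simp
  · exact absurd rfl h2

end History

end Summit.QuantumFields.YangMills.Theorems.BalabanUVNodesN08AlphaHistGeom

end
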